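import Summits.CriticalPhenomena.PercolationContinuityZ3.Theses.PercNearOneGluing
import Literature.Probability.Percolation.PercolationProofs
import Literature.Probability.Percolation.ConditionalPositiveAssociationProofs
import Literature.Probability.Percolation.TwoClusterConditionalAssociationProofs
import Summits.CriticalPhenomena.PercolationContinuityZ3.Theorems.PercNearOneGluingAdditiveGluingGoodTwoRelays

/-! TTRL-lite variant V191 of stmt-CriticalPhenomena-4576 -/

namespace Summit.CriticalPhenomena.PercolationContinuityZ3.Theorems

open MeasureTheory Literature.Probability.LatticeModels Literature.Probability.Percolation
open scoped Classical BigOperators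

/-- TTRL-lite variant V191 (`fix_nat:n=5; card_le:A≤3`) of the registered stub `stub_goodStep` of
stmt-CriticalPhenomena-4576: on five vertices with `A.card ≤ 3` the inductive step of the
good-quadruple (penalised-selection) inequality
`μ(o ↔ A, o ↮ b) + Σ_{W dead} μ(C(o) = W) · μ({sel W ↔ b in Wᶜ}ᶜ) ≤ t`
holds.  With `b ∈ A` and `A.card ≤ 3` there are at most two genuine relays besides `b`, and the
statement is a direct specialisation of the two-relay goodness theorem
`stub_goodStepTwoRelays_k41` (any `n`, `A.card ≤ 3`); neither the live-neighbour hypothesis nor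
the induction hypothesis is needed. [this project] -/
theorem cp4576_goodstep_var191 : ∀ (w : Sym2 (Fin 5) → unitInterval) (A : Finset (Fin 5)) (o b : Fin 5), A.card ≤ 3 → b ∈ A → o ∉ A → (∃ y : Fin 5, y ∉ A ∧ y ≠ o ∧ (w s(o, y) : ℝ) ≠ 0) → (∀ w' : Sym2 (Fin 5) → unitInterval, (Finset.univ.filter (fun v : Fin 5 => ∃ u : Fin 5, 0 < (w' s(u, v) : ℝ))).card < (Finset.univ.filter (fun v : Fin 5 => ∃ u : Fin 5, 0 < (w s(u, v) : ℝ))).card → ∀ (A' : Finset (Fin 5)) (o' b' : Fin 5), b' ∈ A' → o' ∉ A' → ∀ (t : ℝ) (sel : Finset (Fin 5) → Fin 5), (∀ W, sel W ∈ A') → (∀ a ∈ A', 1 - t ≤ (prodBernoulli w').real (openConn a b')) → (prodBernoulli w').real ((⋃ a ∈ A', openConn o' a) ∩ (openConn o' b')ᶜ) + ∑ W ∈ (Finset.univ : Finset (Finset (Fin 5))).filter (fun W => o' ∈ W ∧ Disjoint W A'), (prodBernoulli w').real {ω : BondConfig (Fin 5) | openCluster ω o' = (W : Set (Fin 5))}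 * (prodBernoulli w').real (openConnIn ((W : Set (Fin 5))ᶜ) (sel W) b')ᶜ ≤ t) → ∀ (t : ℝ) (sel : Finset (Fin 5) → Fin 5), (∀ W, sel W ∈ A) → (∀ a ∈ A, 1 - t ≤ (prodBernoulli w).real (openConn a b)) → (prodBernoulli w).real ((⋃ a ∈ A, openConn o a) ∩ (openConn o b)ᶜ) + ∑ W ∈ (Finset.univ : Finset (Finset (Fin 5))).filter (fun W => o ∈ W ∧ Disjoint W A), (prodBernoulli w).real {ω : BondConfig (Fin 5) | openCluster ω o = (W : Set (Fin 5))} * (prodBernoulli w).real (openConnIn ((W : Set (Fin 5))ᶜ) (sel W) b)ᶜ ≤ t := by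
  intro w A o b hA hbA hoA _hy _ih t sel hsel hrel
  exact stub_goodStepTwoRelays_k41 5 w A o b hbA hoA hA t sel hsel hrel

end Summit.CriticalPhenomena.PercolationContinuityZ3.Theorems
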